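import Mathlib
import Summits.ValiantsHypothesis.ValiantsHypothesis.Theorems.BarrierLeverPartitionMinorsHitByVPHiddenStatesSecondShellOriented

/-!
# Route BarrierLever — item `PartitionMinorsHitByVP` (stmt-ValiantsHypothesis-19717), line `hidden-states`:
# ★★ SECOND-SHELL «FUNNEL» CLASSES OF EVERY BALL — by THEOREM 1UZ

Helper file (`--supports stmt-ValiantsHypothesis-19717`; cell valiant-natproofs, 𝒟-side door (c), registered line
`Cruxes/PartitionMinorsHitByVP/Lines/hidden_states.lean` v8; prover seat val-np-p6 gen 17).  Closes NO item; definition-free.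

THE CELL (memo HOME/val-np-p6/g17/MEMO-valnp6-g17.md §4).  Table-free FUNNEL data for `U = B_t(h) ∖ {A₁,A₂} ∪ {C₁,C₂}`: a shared top
`y ∈ (C₁∖A₁) ∩ (C₂∖A₂)` (top of BOTH paths, hence nobody's source), the bottom of path 1 at `x₀ ∈ (C₁∖A₁) ∩ A₂ ∩ C₂` with level-0
attachments `s, s' ∈ (A₁∖C₁) ∩ A₂ ∩ C₂` (`s ≠ s'` unless `|A₁∖C₁| ≤ 1`).  Then `F = {x₀, s, s'}` is forward-closed for every parameter,
`C₂ ∖ y` has three tokens in `F` but `A₁` only the two slots `s, s'`: THEOREM 1UZ (`…OneUnfed.det_eq_zero_of_one_unfed_fwd`) kills the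
cross minor `D_{B − A₁ + C₂}` and `…SecondShellExchange` composes.  ★★ `exists_table_secondShell_funnel`.  (Example: t = 3,
{012,013;0234,1234} with y = 4, x₀ = 3, s = s' = 1.)

HONEST LABEL: conjecture-column cells (second shell, every `t, h`); 19717 stays OPEN; nothing on crux 14610 or VP ≠ VNP.
-/

set_option linter.dupNamespace false

namespace Summit.ValiantsHypothesis.ValiantsHypothesis.Theorems.BarrierLever.HiddenStates

open Finset

noncomputable section

namespace SecondShell

open PathTable

/-- ★★ **SECOND SHELL, FUNNEL CLASSES, EVERY `t, h`.** -/
theorem exists_table_secondShell_funnel (h t : ℕ) (A₁ A₂ C₁ C₂ : Finset (Fin h))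
    (hA₁ : A₁.card = t) (hA₂ : A₂.card = t) (hC₁ : C₁.card = t + 1) (hC₂ : C₂.card = t + 1)
    (h₁ : ¬ A₁ ⊆ C₁) (h₂ : ¬ A₂ ⊆ C₂) (hA : A₁ ≠ A₂) (hC : C₁ ≠ C₂)
    {y x₀ s s' : Fin h} (hy₁ : y ∈ C₁) (hy₂ : y ∉ A₁) (hy₃ : y ∈ C₂) (hy₄ : y ∉ A₂)
    (hx₁ : x₀ ∈ C₁) (hx₂ : x₀ ∉ A₁) (hx₃ : x₀ ∈ A₂) (hx₄ : x₀ ∈ C₂)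
    (hs₁ : s ∈ A₁) (hs₂ : s ∉ C₁) (hs₃ : s ∈ A₂) (hs₄ : s ∈ C₂)
    (hs'₁ : s' ∈ A₁) (hs'₂ : s' ∉ C₁) (hs'₃ : s' ∈ A₂) (hs'₄ : s' ∈ C₂) (hss' : s ≠ s' ∨ (A₁ \ C₁).card ≤ 1)
    {r : ℕ} (u cols : Fin r → Finset (Fin h)) (hu : Function.Injective u)
    (hU : ∀ i, ((u i).card ≤ t ∧ u i ≠ A₁ ∧ u i ≠ A₂) ∨ u i = C₁ ∨ u i = C₂)
    (hcols : ∀ J : Finset (Fin h), J.card ≤ t → ∃ kk, cols kk = J) :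
    ∃ tx : Option (Fin h) → Fin h → ℂ,
      (Matrix.of fun i kk : Fin r => ∏ a ∈ u i, (tx none a + ∑ q ∈ cols kk, tx (some q) a)).det ≠ 0 := by
  classical
  obtain ⟨k₁, j₁, j₁', hk₁, hkj₁, a1, a2, a3, a4⟩ := swap_sizes A₁ C₁ hA₁ hC₁ h₁
  obtain ⟨k₂, j₂, j₂', hk₂, hkj₂, b1, b2, b3, b4⟩ := swap_sizes A₂ C₂ hA₂ hC₂ h₂
  have hyx : y ≠ x₀ := fun h' => hy₄ (h' ▸ hx₃)
  have hss'' : 2 ≤ k₁ → s ≠ s' := by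
    intro h2; rcases hss' with h' | h'
    · exact h'
    · rw [a2] at h'; omega
  obtain ⟨e₁, m1, m2, m3, m4, htop₁, hbot₁, hatt₁, hatt₁'⟩ := exists_equiv_four_oriented A₁ C₁ hk₁ a1 a2 a3 a4
    (Finset.mem_sdiff.2 ⟨hy₁, hy₂⟩) (Finset.mem_sdiff.2 ⟨hx₁, hx₂⟩) hyx (Finset.mem_sdiff.2 ⟨hs₁, hs₂⟩)
    (Finset.mem_sdiff.2 ⟨hs'₁, hs'₂⟩) hss''
  -- a second element of path 2
  obtain ⟨p₂, hp₂, hp₂y⟩ : ∃ p₂ ∈ C₂ \ A₂, p₂ ≠ y := by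
    have hcard : 1 < (C₂ \ A₂).card := by rw [b1]; omega
    obtain ⟨x, hx, y', hy', hxy⟩ := Finset.one_lt_card.1 hcard
    by_cases hxb : x = y
    · exact ⟨y', hy', fun h' => hxy (hxb.trans h'.symm)⟩
    · exact ⟨x, hx, hxb⟩
  obtain ⟨e₂, n1, n2, n3, n4, htop₂, -⟩ := exists_equiv_four_tops A₂ C₂ hk₂ b1 b2 b3 b4
    (Finset.mem_sdiff.2 ⟨hy₃, hy₄⟩) hp₂ (Ne.symm hp₂y)
  let N₁ : Fin h → Fin h → ℂ := fun a q => swapTable' e₁ a q - if q = a then 1 else 0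
  let N₂ : Fin h → Fin h → ℂ := fun a q => swapTable' e₂ a q - if q = a then 1 else 0
  have hT10 : tab2 N₁ N₂ ![1, 0] = swapTable' e₁ := by funext a q; simp [tab2, N₁]
  have hT01 : tab2 N₁ N₂ ![0, 1] = swapTable' e₂ := by funext a q; simp [tab2, N₂]
  -- bookkeeping (verbatim from the immobile-token cell)
  set Ball := Finset.univ.filter fun S : Finset (Fin h) => S.card ≤ t with hBall
  set 𝒰 := insert C₁ (insert C₂ ((Ball.erase A₁).erase A₂)) with h𝒰
  have hBA₁ : A₁ ∈ Ball := Finset.mem_filter.2 ⟨Finset.mem_univ _, by omega⟩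
  have hBA₂ : A₂ ∈ Ball := Finset.mem_filter.2 ⟨Finset.mem_univ _, by omega⟩
  have hBC₁ : C₁ ∉ Ball := fun h' => by have := (Finset.mem_filter.1 h').2; omega
  have hBC₂ : C₂ ∉ Ball := fun h' => by have := (Finset.mem_filter.1 h').2; omega
  have h𝒰card : 𝒰.card = Ball.card := card_secondShell_rows Ball hBA₁ hBA₂ hBC₁ hBC₂ hA hC
  have hUmem : ∀ i, u i ∈ 𝒰 := by
    intro i
    rcases hU i with ⟨hc, hne₁, hne₂⟩ | h' | h'
    · refine Finset.mem_insert_of_mem (Finset.mem_insert_of_mem ?_)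
      exact Finset.mem_erase.2 ⟨hne₂, Finset.mem_erase.2 ⟨hne₁, Finset.mem_filter.2 ⟨Finset.mem_univ _, hc⟩⟩⟩
    · rw [h']; exact Finset.mem_insert_self _ _
    · rw [h']; exact Finset.mem_insert_of_mem (Finset.mem_insert_self _ _)
  obtain ⟨hhit, hcolcard⟩ := rows_cover t 𝒰 h𝒰card u cols hu hUmem hcols
  obtain ⟨i₁, hi₁⟩ := hhit C₁ (Finset.mem_insert_self _ _)
  obtain ⟨i₂, hi₂⟩ := hhit C₂ (Finset.mem_insert_of_mem (Finset.mem_insert_self _ _))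
  have hne : i₁ ≠ i₂ := fun h' => hC (by rw [← hi₁, ← hi₂, h'])
  have hball : ∀ R : Finset (Fin h), R.card ≤ t → R ≠ A₁ → R ≠ A₂ → ∃ i, i ≠ i₁ ∧ i ≠ i₂ ∧ u i = R := by
    intro R hR hR₁ hR₂
    obtain ⟨i, hi⟩ := hhit R (Finset.mem_insert_of_mem (Finset.mem_insert_of_mem
      (Finset.mem_erase.2 ⟨hR₂, Finset.mem_erase.2 ⟨hR₁, Finset.mem_filter.2 ⟨Finset.mem_univ _, hR⟩⟩⟩)))
    refine ⟨i, ?_, ?_, hi⟩ <;> (rintro rfl; first | (rw [hi₁] at hi) | (rw [hi₂] at hi)) <;> (rw [← hi] at hR; omega)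
  let b : Fin r → Finset (Fin h) := Function.update (Function.update u i₁ A₁) i₂ A₂
  have hb₁ : b i₁ = A₁ := by simp only [b, Function.update_of_ne hne, Function.update_self]
  have hb₂ : b i₂ = A₂ := by simp only [b, Function.update_self]
  have hb : ∀ i, i ≠ i₁ → i ≠ i₂ → b i = u i := fun i h1 h2 => by simp only [b, Function.update_of_ne h2, Function.update_of_ne h1]
  have hub : Function.update (Function.update b i₁ C₁) i₂ C₂ = u := by
    funext i
    by_cases h2 : i = i₂
    · subst h2; rw [Function.update_self, hi₂]
    · rw [Function.update_of_ne h2]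
      by_cases h1 : i = i₁
      · subst h1; rw [Function.update_self, hi₁]
      · rw [Function.update_of_ne h1, hb i h1 h2]
  have hbval : ∀ i, i ≠ i₁ → i ≠ i₂ → (b i).card ≤ t ∧ b i ≠ A₁ ∧ b i ≠ A₂ := by
    intro i h1 h2
    rw [hb i h1 h2]
    rcases hU i with h' | h' | h'
    · exact h'
    · exact absurd (hi₁ ▸ h') (fun hh => h1 (hu hh))
    · exact absurd (hi₂ ▸ h') (fun hh => h2 (hu hh))
  have hAu : ∀ i, u i ≠ A₁ ∧ u i ≠ A₂ := by
    intro i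
    rcases hU i with ⟨-, hne₁, hne₂⟩ | h' | h'
    · exact ⟨hne₁, hne₂⟩
    · rw [h']; constructor <;> (intro h''; rw [h''] at hC₁; omega)
    · rw [h']; constructor <;> (intro h''; rw [h''] at hC₂; omega)
  have hbinj : Function.Injective b := by
    refine update_injective _ (update_injective u hu i₁ A₁ fun i => (hAu i).1) i₂ A₂ fun i' => ?_
    by_cases h' : i' = i₁
    · rw [h', Function.update_self]; exact hA
    · rw [Function.update_of_ne h']; exact (hAu i').2
  have hC₁b : ∀ i, b i ≠ C₁ := by
    intro i h'
    by_cases h1 : i = i₁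
    · rw [h1, hb₁] at h'; rw [h'] at hA₁; omega
    by_cases h2 : i = i₂
    · rw [h2, hb₂] at h'; rw [h'] at hA₂; omega
    · rw [hb i h1 h2, ← hi₁] at h'; exact h1 (hu h')
  have hC₂b : ∀ i, b i ≠ C₂ := by
    intro i h'
    by_cases h1 : i = i₁
    · rw [h1, hb₁] at h'; rw [h'] at hA₁; omega
    by_cases h2 : i = i₂
    · rw [h2, hb₂] at h'; rw [h'] at hA₂; omega
    · rw [hb i h1 h2, ← hi₂] at h'; exact h2 (hu h')
  have hF1 : (mat (tab2 N₁ N₂ ![1, 0]) (Function.update b i₁ C₁) cols).det ≠ 0 := by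
    rw [hT10]
    refine swapTable'_det_ne_zero hk₁ A₁ C₁ e₁ m1 m2 m3 m4 _ cols (update_injective b hbinj i₁ C₁ hC₁b) ?_
      (by rw [hkj₁]; exact hcols)
    intro i
    by_cases hi : i = i₁
    · right; rw [hi, Function.update_self]
    · left
      rw [Function.update_of_ne hi]
      by_cases h2 : i = i₂
      · rw [h2, hb₂]; exact ⟨by omega, Ne.symm hA⟩
      · have := hbval i hi h2; exact ⟨by rw [hkj₁]; exact this.1, this.2.1⟩
  have hF2 : (mat (tab2 N₁ N₂ ![0, 1]) (Function.update b i₂ C₂) cols).det ≠ 0 := by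
    rw [hT01]
    refine swapTable'_det_ne_zero hk₂ A₂ C₂ e₂ n1 n2 n3 n4 _ cols (update_injective b hbinj i₂ C₂ hC₂b) ?_
      (by rw [hkj₂]; exact hcols)
    intro i
    by_cases hi : i = i₂
    · right; rw [hi, Function.update_self]
    · left
      rw [Function.update_of_ne hi]
      by_cases h1 : i = i₁
      · rw [h1, hb₁]; exact ⟨by omega, hA⟩
      · have := hbval i h1 hi; exact ⟨by rw [hkj₂]; exact this.1, this.2.2⟩
  -- THEOREM 1UZ kills the cross minor `D_{B − A₁ + C₂}`: `q = y`, `F = {x₀, s, s'}`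
  have hZ : ∀ ε, (mat (tab2 N₁ N₂ ε) (Function.update b i₁ C₂) cols).det = 0 := by
    intro ε
    have hdiag : ∀ a, tab2 N₁ N₂ ε a a = 1 := by intro a; simp [tab2, N₁, N₂, swapTable'_self]
    -- `y` is nobody's source
    have hcy1 : ∀ a, a ≠ y → swapTable' e₁ a y = 0 := fun a ha =>
      swapTable'_col_unit A₁ C₁ e₁ m1 m2 (fun h' => hy₂ (Finset.mem_sdiff.1 h').1) (fun _ => htop₁.symm) ha
    have hcy2 : ∀ a, a ≠ y → swapTable' e₂ a y = 0 := fun a ha =>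
      swapTable'_col_unit A₂ C₂ e₂ n1 n2 (fun h' => hy₄ (Finset.mem_sdiff.1 h').1) (fun _ => htop₂.symm) ha
    have hcol : ∀ a, a ≠ y → tab2 N₁ N₂ ε a y = 0 := by
      intro a ha; simp only [tab2, N₁, N₂, hcy1 a ha, hcy2 a ha, if_neg (Ne.symm ha)]; ring
    -- the trap `F = {x₀, s, s'}`
    have hrow1 : ∀ a, a ∉ C₁ \ A₁ → ∀ d, d ≠ a → swapTable' e₁ a d = 0 := by
      intro a ha d hd; by_contra h'; exact ha (swapTable'_offdiag A₁ C₁ e₁ m1 h' hd)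
    have hrow2 : ∀ a, a ∈ A₂ → ∀ d, d ≠ a → swapTable' e₂ a d = 0 := by
      intro a ha d hd; by_contra h'; exact (Finset.mem_sdiff.1 (swapTable'_offdiag A₂ C₂ e₂ n1 h' hd)).2 ha
    have hbot : ∀ d, d ≠ x₀ → swapTable' e₁ x₀ d ≠ 0 → d = s ∨ d = s' := by
      intro d hd h'
      rw [← hbot₁] at h' hd
      obtain ⟨i, hi, rfl⟩ := swapTable'_bottom_row e₁ h' hd
      by_cases hi0 : (i : ℕ) = 0
      · left
        have hi' : i = ⟨0, by omega⟩ := Fin.ext hi0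
        rw [hi', hatt₁]
      · right
        have h2 : 2 ≤ k₁ := by have := i.isLt; omega
        have hi' : i = ⟨1, by omega⟩ := Fin.ext (by simp; omega)
        rw [hi', hatt₁' h2]
    have hF : ∀ a ∈ ({x₀, s, s'} : Finset (Fin h)), ∀ d, tab2 N₁ N₂ ε a d ≠ 0 → d ∈ ({x₀, s, s'} : Finset (Fin h)) := by
      intro a ha d hd
      simp only [Finset.mem_insert, Finset.mem_singleton] at ha ⊢
      by_contra hdF
      push Not at hdF
      apply hd
      rcases ha with rfl | rfl | rfl
      · have hda : d ≠ a := hdF.1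
        have h2 : swapTable' e₂ a d = 0 := hrow2 a hx₃ d hda
        have h1 : swapTable' e₁ a d = 0 := by
          by_contra h'; rcases hbot d hda h' with rfl | rfl
          · exact hdF.2.1 rfl
          · exact hdF.2.2 rfl
        simp only [tab2, N₁, N₂, h1, h2, if_neg hda]; ring
      · have hda : d ≠ a := hdF.2.1
        have h1 : swapTable' e₁ a d = 0 := hrow1 a (fun h' => (Finset.mem_sdiff.1 h').2 hs₁) d hda
        have h2 : swapTable' e₂ a d = 0 := hrow2 a hs₃ d hda
        simp only [tab2, N₁, N₂, h1, h2, if_neg hda]; ring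
      · have hda : d ≠ a := hdF.2.2
        have h1 : swapTable' e₁ a d = 0 := hrow1 a (fun h' => (Finset.mem_sdiff.1 h').2 hs'₁) d hda
        have h2 : swapTable' e₂ a d = 0 := hrow2 a hs'₃ d hda
        simp only [tab2, N₁, N₂, h1, h2, if_neg hda]; ring
    -- token count: `A₁ ∩ F = {s, s'}`, `(C₂ ∖ y) ∩ F = F`
    have hcount : (A₁ ∩ {x₀, s, s'}).card < ((Function.update b i₁ C₂ i₁).erase y ∩ {x₀, s, s'}).card := by
      rw [Function.update_self]
      have h1 : A₁ ∩ ({x₀, s, s'} : Finset (Fin h)) = ({x₀, s, s'} : Finset (Fin h)).erase x₀ := by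
        ext z
        simp only [Finset.mem_inter, Finset.mem_insert, Finset.mem_singleton, Finset.mem_erase]
        constructor
        · rintro ⟨hz, hz'⟩
          refine ⟨fun h' => hx₂ (h' ▸ hz), hz'⟩
        · rintro ⟨hz, hz'⟩
          rcases hz' with rfl | rfl | rfl
          · exact (hz rfl).elim
          · exact ⟨hs₁, Or.inr (Or.inl rfl)⟩
          · exact ⟨hs'₁, Or.inr (Or.inr rfl)⟩
      have h2 : C₂.erase y ∩ ({x₀, s, s'} : Finset (Fin h)) = ({x₀, s, s'} : Finset (Fin h)) := by
        ext z
        simp only [Finset.mem_inter, Finset.mem_insert, Finset.mem_singleton, Finset.mem_erase]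
        constructor
        · exact fun h' => h'.2
        · intro hz
          refine ⟨⟨?_, ?_⟩, hz⟩
          · rcases hz with rfl | rfl | rfl
            · exact fun h' => hyx h'.symm
            · exact fun h' => hy₂ (h' ▸ hs₁)
            · exact fun h' => hy₂ (h' ▸ hs'₁)
          · rcases hz with rfl | rfl | rfl
            · exact hx₄
            · exact hs₄
            · exact hs'₄
      rw [h1, h2]
      have := Finset.card_erase_add_one (Finset.mem_insert_self x₀ ({s, s'} : Finset (Fin h)))
      omega
    refine det_eq_zero_of_one_unfed_fwd (tab2 N₁ N₂ ε) hcol (hdiag y) {x₀, s, s'} hF t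
      (Function.update b i₁ C₂) cols hcolcard i₁ (by rw [Function.update_self, hC₂])
      (by rw [Function.update_self]; exact hy₃) A₁ hA₁ hy₂ ?_ ?_ ?_ hcount
    · intro i
      by_cases hi : i = i₁
      · rw [hi, Function.update_self]; intro h'; rw [h'] at hC₂; omega
      · rw [Function.update_of_ne hi]
        by_cases h2 : i = i₂
        · rw [h2, hb₂]; exact Ne.symm hA
        · exact (hbval i hi h2).2.1
    · intro i hi
      rw [Function.update_of_ne hi]
      by_cases h2 : i = i₂
      · rw [h2, hb₂]; omega
      · exact (hbval i hi h2).1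
    · intro R hR hR₁
      by_cases hR₂ : R = A₂
      · exact ⟨i₂, Ne.symm hne, by rw [Function.update_of_ne (Ne.symm hne), hb₂, hR₂]⟩
      · obtain ⟨i, hi1, hi2, hi⟩ := hball R hR hR₁ hR₂
        exact ⟨i, hi1, by rw [Function.update_of_ne hi1, hb i hi1 hi2, hi]⟩
  obtain ⟨tx, htx⟩ := exists_table_of_cross_zero N₁ N₂ b cols hne C₁ C₂ hF1 hF2 (Or.inl hZ)
  exact ⟨tx, by rw [hub] at htx; exact htx⟩

end SecondShell

end

end Summit.ValiantsHypothesis.ValiantsHypothesis.Theorems.BarrierLever.HiddenStates
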